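import Literature.AnabelianGeometry.AbsoluteAnabelian.AbsTopIII.Thm19EvaluationSaturated
import Literature.AnabelianGeometry.AbsoluteAnabelian.AbsTopIII.Thm19KummerTowerDictionaryProofs
import HarnessLib

/-!
# [AbsTopIII] Thm. 1.9 (e) for SATURATED systems: closers of `Thm19eSat` (proof-only)

Mochizuki, *Topics in Absolute Anabelian Geometry III*, §1, Theorem 1.9 (e), manuscript p. 38 (lit key
`paper:url-5493eb38cbb7`).  Proof-only companion of `Thm19EvaluationSaturated.lean` (abc-iut-w5-d213;
sub-DAG `plan/L4/SUBDAG-AbsTopIII-Thm19.md`, row Thm19.e.r11; repair of the self-audit finding "`Thm19e`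
over-quantifies over deficient systems"): the closers of the repaired statement `Thm19eSat` —
`thm19eSat_of_thm19e` (the repair weakens), `thm19eSat_of_dictionary` (the dictionary hypothesis of
`thm19e_of_dictionary`, p421595, now asked ONLY for saturated systems — satisfiable at the intended model)
and `thm19eSat_of_dictionaryTower` (ONE `NFDictionary` per SATURATED system; p424453/p424482).  The
assembly (`exists_isIso_evaluationTriple`, `NFDictionary.exists_isIso`) is unchanged.  No definition, no
new named fact; nothing here bears on [IUTchIII] Cor. 3.12.
-/

noncomputable section

open CategoryTheory
open scoped Classical

namespace Literature.AnabelianGeometry.AbsoluteAnabelian.AbsTopIII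

open Literature.NumberTheory.DiophantineGeometry
open Literature.NumberTheory.DiophantineGeometry.AlgFunctionField

universe u

namespace IntrinsicKummerModel

/-- `Thm19e` (all systems) implies `Thm19eSat` (saturated systems): the repair WEAKENS the
over-quantified statement. [cite: MochizukiAbsTopIII2015, Thm 1.9 (e) p.38] -/
theorem thm19eSat_of_thm19e (M : IntrinsicKummerModel.{u}) (h : M.Thm19e) : M.Thm19eSat :=
  fun Z hZ ι _ _ _ S _ => h Z hZ ι S

/-- **Thm. 1.9 (e) for saturated systems, modulo the levelwise dictionary**: as `thm19e_of_dictionary`,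
with the dictionary ((e0) algebra/function-field/genus structure, the embedding, (e1) point dictionary
with surjectivity, (e2) orders, (e3) values) asked ONLY for SATURATED systems — for which the point
dictionary IS surjective at the intended model. [cite: MochizukiAbsTopIII2015, Thm 1.9 (e) p.38] -/
theorem thm19eSat_of_dictionary (M : IntrinsicKummerModel.{u})
    (hdict : ∀ (Z : M.Curve), M.IsThm19dInput Z → ∀ (ι : Type u) [Preorder ι] [Nonempty ι]
      [IsDirectedOrder ι] (S : CurveModel.NFComplementSystem M.toCurveModel Z ι), M.IsSaturated S →
      ∃ (_ : Algebra ↥(M.kbarNF Z) (M.NFFunctionField Z))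
        (_ : IsAlgFunctionField ↥(M.kbarNF Z) (M.NFFunctionField Z)),
        2 ≤ genus ↥(M.kbarNF Z) (M.NFFunctionField Z) ∧
        ∃ (e : Additive (M.NFFunctionField Z)ˣ →+ S.kummerContainer)
          (π : M.NFPointIndex S → PlaceOver ↥(M.kbarNF Z) (M.NFFunctionField Z)),
          Function.Injective e ∧ Set.range e = M.functionFieldPart S ∧
          (∀ a b, M.SamePoint S a b ↔ π a = π b) ∧ Function.Surjective π ∧
          (∀ (f : (M.NFFunctionField Z)ˣ) (a : M.NFPointIndex S) (n : ℤ),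
            M.HasOrderAt S (e (Additive.ofMul f)) a n ↔ (π a).ord (f : M.NFFunctionField Z) = n) ∧
          (∀ (f : (M.NFFunctionField Z)ˣ) (a : M.NFPointIndex S),
            M.HasValueOneAt S (e (Additive.ofMul f)) a ↔ f ∈ unitsWithValueOne (π a))) :
    M.Thm19eSat := by
  intro Z hZ ι _ _ _ S hS
  obtain ⟨_, _, hg, e, π, he, hrange, hπ, hπs, hord, hval⟩ := hdict Z hZ ι S hS
  obtain ⟨φ, σ, hiso⟩ := M.exists_isIso_evaluationTriple S e he hrange π hπ hπs hord hval
  exact ⟨↥(M.kbarNF Z), M.NFFunctionField Z, inferInstance, inferInstance, inferInstance,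
    M.isAlgClosed_kbarNF Z, inferInstance, hg, ⟨RingEquiv.refl _⟩, ⟨RingEquiv.refl _⟩, φ, σ, hiso⟩

/-- **Thm. 1.9 (e) for saturated systems over dictionary-towers**: as `thm19e_of_dictionaryTower`, with
ONE `NFDictionary` asked only for SATURATED systems (whose point dictionary can be surjective); Prop. 1.6
(i)(iii), Prop. 1.8 (i)(ii), Rmk. 1.5.4 (i) BY NAME. [cite: MochizukiAbsTopIII2015, Thm 1.9 (e) p.38] -/
theorem thm19eSat_of_dictionaryTower (M : IntrinsicKummerModel.{u}) (h18i : M.Prop_1_8_i)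
    (h18ii : M.Prop_1_8_ii) (h16u : M.Prop_1_6_iii_units) (h16k : M.Prop_1_6_iii_ker)
    (h16 : M.Prop_1_6_i) (h154 : Rmk_1_5_4_i.{u})
    (hD : ∀ (Z : M.Curve), M.IsThm19dInput Z → ∀ (ι : Type u) [Preorder ι] [Nonempty ι]
      [IsDirectedOrder ι] (S : CurveModel.NFComplementSystem M.toCurveModel Z ι), M.IsSaturated S →
      ∃ (Ω : Type u) (_ : Field Ω) (_ : Algebra ↥(M.kbarNF Z) (M.NFFunctionField Z)),
        Nonempty (M.NFDictionary S Ω)) :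
    M.Thm19eSat := by
  intro Z hZ ι _ _ _ S hS
  obtain ⟨Ω, _, _, ⟨D⟩⟩ := hD Z hZ ι S hS
  obtain ⟨φ, σ, hiso⟩ := D.exists_isIso hZ h18i h18ii h16u h16k h16 h154
  have hg : 2 ≤ genus ↥(M.kbarNF Z) (M.NFFunctionField Z) := by
    rw [D.genus_eq]
    exact hZ.two_le_genus
  exact ⟨↥(M.kbarNF Z), M.NFFunctionField Z, inferInstance, inferInstance, inferInstance,
    M.isAlgClosed_kbarNF Z, D.isAlgFunctionField, hg, ⟨RingEquiv.refl _⟩, ⟨RingEquiv.refl _⟩,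
    φ, σ, hiso⟩

end IntrinsicKummerModel

end Literature.AnabelianGeometry.AbsoluteAnabelian.AbsTopIII
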